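import Literature.Probability.LatticeModels.PlaneRotatorLiebSlabCriterion
import Literature.Probability.LatticeModels.LayeredPlaneRotatorBoxDecoupling
import HarnessLib

/-!
# The slab number of the layered XY model is bounded by TWO-DIMENSIONAL box data:
# `S^{slab}_R(β; J∥, J⊥) ≤ S_R(βJ∥) + βJ⊥ · χ^{int}_R(βJ∥)`

Lieb's finite algorithm for the layered plane-rotator model with the SLAB `[−R,R]² × {−1,0,1}` as inside system
(`PlaneRotatorLiebSlabCriterion.lean`, `twoPoint_layered_le_pow_slabShellSum`): `⟨cos(θ_a − θ_c)⟩_Λ ≤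
(S^{slab}_R)^{max(⌊|Δ₁|/R⌋, ⌊|Δ₂|/R⌋, |Δℓ|)}` on every finite `Λ ⊂ ℤ³`. In the slab reference system all
shell–shell bonds belong to Lieb's `H_C` (E. H. Lieb, Comm. Math. Phys. **77** (1980) 127 [Lieb1980], p. 133), so
the layers `±1` carry no in-plane bonds: their sites are DANGLING vertical leaves on the interior of the middle layer
(or free rotators above its shell). Dangling bonds integrate out (`twoPoint_add_leaf_eq`) and a leaf is bounded by
Aizenman–Simon's local Ward inequality at the leaf (`twoPoint_add_leaf_le`, `LayeredPlaneRotatorDecoupling.lean`;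
M. Aizenman, B. Simon, Comm. Math. Phys. **77** (1980) 137, Thm 3.1). Hence (this file):

* `boxInteriorSum K R` — the **interior susceptibility of the centre** in the two-dimensional reference box
  `[−R,R]²` (shell free) at coupling `K`: `χ^{int}_R(K) = ∑_{‖y‖_∞ < R} ⟨cos(θ_0 − θ_y)⟩_{box}` — a finite number
  of the 2D box, like Lieb's `S_R(K) = nnBoxShellSum K 2 R`.
* **`slabShellSum_le_box2D`**: `S^{slab}_R(β; J∥, J⊥) ≤ S_R(βJ∥) + β J⊥ · χ^{int}_R(βJ∥)` (`β, J∥, J⊥ ≥ 0`, `R ≥ 1`).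
* **`twoPoint_layered_le_pow_box2D`**, **`twoPoint_layered_le_pow_box2D_layer`**: on every finite `Λ ⊂ ℤ³`,
  `⟨cos(θ_a − θ_c)⟩_{Λ,β} ≤ (S_R(βJ∥) + βJ⊥ χ^{int}_R(βJ∥))^{d}` with `d` the slab index, resp. `d = |ℓ(a) − ℓ(c)|`
  when the base is `≤ 1`.

So the three-dimensional ordering of the layered classical XY model is controlled END-TO-END BY TWO NUMBERS OF ONE
TWO-DIMENSIONAL BOX: `k_B T_c^{3D-XY}(J∥, J⊥) ≤ T` as soon as `S_R(J∥/T) + (J⊥/T)·χ^{int}_R(J∥/T) < 1` — the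
box-localised form of the layer-decoupling theorem (`twoPoint_layered_le_pow_interlayer'`, whose `χ` is the
susceptibility of a whole layer of `Λ`) with the exact small-`J⊥` limit `S_R(J∥/T) < 1`. Cell `pub/hubbard-tc`
(MO-S3, keys K4-c/K5, INTERLAYER L3): classical effective model only; the numbers `S_R`, `χ^{int}_R` are certified
numerics outside the tree (`R = 2`: `S_2 = u(4G_e + 8G_c)`, `χ^{int}_2 = 1 + 4G_e + 4G_c` of the free `3×3` block).

References: [Lieb1980] eq. (23), p. 128 and p. 133; [AizenmanSimon1980LocalWard] Thm 3.1; [Ginibre1970] Prop. 3 /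
Example 4; L. L. Liu, H. E. Stanley [LiuStanley1972] (layered couplings).
-/

noncomputable section

open MeasureTheory Finset
open scoped BigOperators

namespace Literature.Probability.LatticeModels

namespace PlaneRotator

open Literature.Barriers.CriticalPhenomena Literature.Barriers.CriticalPhenomena.LongRangeIsing

section SlabReduction

variable [MeasurableSpace Circle] [BorelSpace Circle]

/-- The **interior susceptibility of the centre in the two-dimensional reference box** `[−R, R]²` at coupling `K`
(shell–shell bonds removed): `χ^{int}_R(K) = ∑_{‖y‖_∞ < R} ⟨cos(θ_0 − θ_y)⟩_{box}` — the in-plane factor of the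
vertical-leaf contributions to the slab number. [cite: Lieb1980, p. 128 (boxes); AizenmanSimon1980LocalWard, Thm 3.1 (N = 2)] -/
def boxInteriorSum (K : ℝ) (R : ℕ) : ℝ :=
  ∑ y ∈ (Finset.univ : Finset (box 2 R)).filter (fun y : box 2 R => Site.supNorm (y : Site 2) < R),
    twoPoint (refCoupling (fun x y : Site 2 => K / 2 * nnCoupling 2 x y) R) (refCentre 2 R) y

/-- `χ^{int}_R(K) ≥ 0` (Griffiths' first inequality). [cite: Ginibre1970, Example 4 (plane rotators)] -/
theorem boxInteriorSum_nonneg {K : ℝ} (hK : 0 ≤ K) (R : ℕ) : 0 ≤ boxInteriorSum K R :=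
  Finset.sum_nonneg fun y _ => twoPoint_nonneg
    (refCoupling_nonneg (fun x y => mul_nonneg (by positivity) (nnCoupling_nonneg _ _)) R) _ y

omit [MeasurableSpace Circle] [BorelSpace Circle] in
/-- Coordinates of the slab radius vector `(R, R, 1)`. [folklore] -/
private theorem slabRadii_apply (R : ℕ) :
    slabRadii R 0 = R ∧ slabRadii R 1 = R ∧ slabRadii R 2 = 1 := by
  simp [slabRadii]

omit [MeasurableSpace Circle] [BorelSpace Circle] in
/-- Membership in the slab box `[−R,R]² × {−1,0,1}`. [folklore] -/
private theorem mem_slab_iff {R : ℕ} {y : Site 3} :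
    y ∈ abox (slabRadii R) ↔ (y 0).natAbs ≤ R ∧ (y 1).natAbs ≤ R ∧ (y 2).natAbs ≤ 1 := by
  rw [mem_abox]
  obtain ⟨h0, h1, h2⟩ := slabRadii_apply R
  constructor
  · intro h
    exact ⟨(slabRadii_apply R).1 ▸ h 0, (slabRadii_apply R).2.1 ▸ h 1, (slabRadii_apply R).2.2 ▸ h 2⟩
  · rintro ⟨g0, g1, g2⟩ i
    fin_cases i
    · exact h0.symm ▸ g0
    · exact h1.symm ▸ g1
    · exact h2.symm ▸ g2

omit [MeasurableSpace Circle] [BorelSpace Circle] in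
/-- Membership in the slab interior: the interior of the middle layer. [folklore] -/
private theorem mem_slabInterior_iff {R : ℕ} {y : Site 3} :
    y ∈ aInterior (slabRadii R) ↔ (y 0).natAbs < R ∧ (y 1).natAbs < R ∧ y 2 = 0 := by
  rw [mem_aInterior]
  obtain ⟨h0, h1, h2⟩ := slabRadii_apply R
  constructor
  · intro h
    refine ⟨h0 ▸ h 0, h1 ▸ h 1, ?_⟩
    have := h 2
    rw [h2] at this
    omega
  · rintro ⟨g0, g1, g2⟩ i
    fin_cases i
    · exact h0.symm ▸ g0
    · exact h1.symm ▸ g1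
    · show (y 2).natAbs < slabRadii R 2
      rw [h2, g2]; decide

omit [MeasurableSpace Circle] [BorelSpace Circle] in
/-- A nearest-neighbour bond between different layers is vertical: the in-plane coordinates agree. [folklore] -/
private theorem inPlane_eq_of_l1Norm_eq_one {x y : Site 3} (h1 : l1Norm (x - y) = 1) (h2 : x 2 ≠ y 2) :
    x 0 = y 0 ∧ x 1 = y 1 := by
  unfold l1Norm at h1
  rw [Fin.sum_univ_three] at h1
  simp only [Pi.sub_apply] at h1
  have h2' : (x 2 - y 2).natAbs ≠ 0 := by
    intro h; apply h2; have := Int.natAbs_eq_zero.1 h; omega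
  constructor
  · have : (x 0 - y 0).natAbs = 0 := by omega
    have := Int.natAbs_eq_zero.1 this; omega
  · have : (x 1 - y 1).natAbs = 0 := by omega
    have := Int.natAbs_eq_zero.1 this; omega

omit [MeasurableSpace Circle] [BorelSpace Circle] in
/-- In-plane `ℓ¹` distance of two sites of the same layer. [folklore] -/
private theorem l1Norm_eq_planeProj {x y : Site 3} (h : x 2 = y 2) :
    l1Norm (x - y) = l1Norm (planeProj x - planeProj y) := by
  unfold l1Norm planeProj
  rw [Fin.sum_univ_three, Fin.sum_univ_two]
  simp [h]

omit [MeasurableSpace Circle] [BorelSpace Circle] in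
/-- The `ℓ^∞` norm of the in-plane projection. [folklore] -/
private theorem supNorm_planeProj_le_iff {y : Site 3} {R : ℕ} :
    Site.supNorm (planeProj y) ≤ R ↔ (y 0).natAbs ≤ R ∧ (y 1).natAbs ≤ R := by
  rw [Site.supNorm_le_iff, Fin.forall_fin_two]
  simp [planeProj]

omit [MeasurableSpace Circle] [BorelSpace Circle] in
/-- The `ℓ^∞` norm of the in-plane projection, strict version. [folklore] -/
private theorem supNorm_planeProj_lt_iff {y : Site 3} {R : ℕ} (hR : 1 ≤ R) :
    Site.supNorm (planeProj y) < R ↔ (y 0).natAbs < R ∧ (y 1).natAbs < R := by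
  have h : Site.supNorm (planeProj y) < R ↔ Site.supNorm (planeProj y) ≤ R - 1 := by omega
  rw [h, supNorm_planeProj_le_iff]
  omega
set_option maxHeartbeats 400000 in
/-- **The slab number is bounded by two-dimensional box data.** For `β, J∥, J⊥ ≥ 0` and `R ≥ 1`:

  `S^{slab}_R(β; J∥, J⊥) ≤ S_R(βJ∥) + β J⊥ · χ^{int}_R(βJ∥)`,

`S_R = nnBoxShellSum (βJ∥) 2 R` Lieb's two-dimensional box number and `χ^{int}_R = boxInteriorSum (βJ∥) R`. (In the
slab reference system the middle layer is the 2D reference box and the outer layers are dangling vertical leaves on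
its interior, or free rotators: dangling bonds integrate out for the in-plane shell sites, and each leaf is at most
`(βJ⊥/2)·⟨cos(θ_0 − θ_foot)⟩_{2D box}` by the local Ward inequality at the leaf.)
[cite: Lieb1980, p. 128 and p. 133 (boxes; B–B interactions part of H_C); AizenmanSimon1980LocalWard, Thm 3.1 (N = 2)] -/
theorem slabShellSum_le_box2D {β Jp Jz : ℝ} (hβ : 0 ≤ β) (hp : 0 ≤ Jp) (hz : 0 ≤ Jz) {R : ℕ} (hR : 1 ≤ R) :
    slabShellSum β Jp Jz R ≤ nnBoxShellSum (β * Jp) 2 R + β * Jz * boxInteriorSum (β * Jp) R := by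
  classical
  -- the slab reference system and its decomposition into the middle layer and the vertical leaves
  set Jf : Site 3 → Site 3 → ℝ := fun x y => β / 2 * layeredCoupling Jp Jz x y with hJf
  have hJf0 : ∀ x y, 0 ≤ Jf x y := fun x y => mul_nonneg (by positivity) (layeredCoupling_nonneg hp hz _ _)
  set aRef := aRefCoupling Jf (slabRadii R) with haRef
  have haRef0 : ∀ p, 0 ≤ aRef p := aRefCoupling_nonneg hJf0 (slabRadii R)
  set L : Finset (abox (slabRadii R)) := Finset.univ.filter fun b => (b : Site 3) 2 = 0 with hL
  have memL : ∀ b : abox (slabRadii R), b ∈ L ↔ (b : Site 3) 2 = 0 := fun b => by simp [hL]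
  -- the foot of a site: its vertical projection onto the middle layer
  have hfoot_mem : ∀ b : abox (slabRadii R), Function.update (b : Site 3) 2 0 ∈ abox (slabRadii R) := by
    intro b
    have hb := mem_slab_iff.1 b.2
    rw [mem_slab_iff]
    simp only [Function.update_self, ne_eq, Fin.reduceEq, not_false_eq_true, Function.update_of_ne,
      Int.natAbs_zero, zero_le_one, and_true]
    exact ⟨by simpa using hb.1, by simpa using hb.2.1⟩
  set foot : abox (slabRadii R) → abox (slabRadii R) := fun b => ⟨Function.update (b : Site 3) 2 0, hfoot_mem b⟩ with hfootdef
  have foot_val : ∀ b : abox (slabRadii R), ((foot b : abox (slabRadii R)) : Site 3) = Function.update (b : Site 3) 2 0 := fun b => rfl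
  have foot0 : ∀ b : abox (slabRadii R), ((foot b : abox (slabRadii R)) : Site 3) 0 = (b : Site 3) 0 := fun b => by
    rw [foot_val]; simp
  have foot1 : ∀ b : abox (slabRadii R), ((foot b : abox (slabRadii R)) : Site 3) 1 = (b : Site 3) 1 := fun b => by
    rw [foot_val]; simp
  have foot2 : ∀ b : abox (slabRadii R), ((foot b : abox (slabRadii R)) : Site 3) 2 = 0 := fun b => by
    rw [foot_val]; simp
  have hfootL : ∀ v, v ∉ L → foot v ∈ L := fun v _ => (memL _).2 (foot2 v)
  set J₀ : abox (slabRadii R) × abox (slabRadii R) → ℝ := fun p =>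
    if ((p.1 : Site 3) 2 = 0 ∧ (p.2 : Site 3) 2 = 0) then aRef p else 0 with hJ₀
  set D : abox (slabRadii R) × abox (slabRadii R) → ℝ := fun p =>
    if (((p.1 : Site 3) 2 = 0 ∧ (p.2 : Site 3) 2 ≠ 0) ∨ ((p.1 : Site 3) 2 ≠ 0 ∧ (p.2 : Site 3) 2 = 0))
      then aRef p else 0 with hD
  have hJ₀0 : ∀ p, 0 ≤ J₀ p := fun p => by simp only [hJ₀]; split_ifs; exacts [haRef0 p, le_rfl]
  have hD0 : ∀ p, 0 ≤ D p := fun p => by simp only [hD]; split_ifs; exacts [haRef0 p, le_rfl]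
  -- interior sites lie in the middle layer; off-layer pairs carry no reference bond
  have hint2 : ∀ {y : Site 3}, y ∈ aInterior (slabRadii R) → y 2 = 0 := fun hy => by
    rw [mem_slabInterior_iff] at hy; exact hy.2.2
  have hdecomp : aRef = J₀ + D := by
    funext p
    simp only [Pi.add_apply, hJ₀, hD]
    by_cases h1 : (p.1 : Site 3) 2 = 0
    · by_cases h2 : (p.2 : Site 3) 2 = 0
      · rw [if_pos ⟨h1, h2⟩, if_neg, add_zero]
        rintro (⟨-, h⟩ | ⟨h, -⟩)
        · exact h h2
        · exact h h1
      · rw [if_neg (fun h => h2 h.2), if_pos (Or.inl ⟨h1, h2⟩), zero_add]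
    · by_cases h2 : (p.2 : Site 3) 2 = 0
      · rw [if_neg (fun h => h1 h.1), if_pos (Or.inr ⟨h1, h2⟩), zero_add]
      · rw [if_neg (fun h => h1 h.1), if_neg, add_zero]
        · -- both off the middle layer: both outside the interior, the bond is removed
          simp only [haRef, aRefCoupling]
          rw [if_pos ⟨fun h => h1 (hint2 h), fun h => h2 (hint2 h)⟩]
        · rintro (⟨h, -⟩ | ⟨-, h⟩)
          · exact h1 h
          · exact h2 h
  have hJ₀supp : ∀ p, J₀ p ≠ 0 → p.1 ∈ L ∧ p.2 ∈ L := by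
    intro p hp
    simp only [hJ₀] at hp
    split_ifs at hp with h
    · exact ⟨(memL _).2 h.1, (memL _).2 h.2⟩
    · exact absurd rfl hp
  -- a present vertical bond joins a leaf to its foot
  have hvert : ∀ b y : abox (slabRadii R), (b : Site 3) 2 ≠ 0 → (y : Site 3) 2 = 0 → aRef (b, y) ≠ 0 ∨ aRef (y, b) ≠ 0 →
      y = foot b := by
    intro b y hb hy hne
    have hl1 : l1Norm ((b : Site 3) - (y : Site 3)) = 1 := by
      by_contra hne1
      have h1 : Jf b y = 0 := by simp only [hJf]; unfold layeredCoupling; rw [if_neg hne1, mul_zero]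
      have h2 : Jf y b = 0 := by
        simp only [hJf]; unfold layeredCoupling; rw [l1Norm_sub_comm, if_neg hne1, mul_zero]
      rcases hne with h | h
      · apply h; simp only [haRef, aRefCoupling]; split_ifs <;> [rfl; exact h1]
      · apply h; simp only [haRef, aRefCoupling]; split_ifs <;> [rfl; exact h2]
    have hne2 : (b : Site 3) 2 ≠ (y : Site 3) 2 := by rw [hy]; exact hb
    obtain ⟨e0, e1⟩ := inPlane_eq_of_l1Norm_eq_one hl1 hne2
    apply Subtype.ext
    rw [foot_val]
    funext i
    fin_cases i
    · simpa using e0.symm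
    · simpa using e1.symm
    · simpa using hy
  have hDsupp : ∀ p, D p ≠ 0 → (p.1 ∉ L ∧ p.2 = foot p.1) ∨ (p.2 ∉ L ∧ p.1 = foot p.2) := by
    intro p hp
    simp only [hD] at hp
    split_ifs at hp with h
    · rcases h with ⟨h1, h2⟩ | ⟨h1, h2⟩
      · right
        refine ⟨fun hm => h2 ((memL _).1 hm), ?_⟩
        exact hvert p.2 p.1 h2 h1 (Or.inr hp)
      · left
        refine ⟨fun hm => h1 ((memL _).1 hm), ?_⟩
        exact hvert p.1 p.2 h1 h2 (Or.inl hp)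
    · exact absurd rfl hp
  -- the centre lies in the middle layer
  set c : abox (slabRadii R) := aCentre (slabRadii R) with hc
  have hc2 : (c : Site 3) 2 = 0 := rfl
  have hcL : c ∈ L := (memL c).2 hc2
  -- the comparison map onto the two-dimensional reference box (injective on each layer)
  have hτ_mem : ∀ b : abox (slabRadii R), planeProj (b : Site 3) ∈ box 2 R := fun b => by
    have hb := mem_slab_iff.1 b.2
    rw [mem_box_iff_supNorm_le, supNorm_planeProj_le_iff]
    exact ⟨hb.1, hb.2.1⟩
  set τ : abox (slabRadii R) → box 2 R := fun b => ⟨planeProj (b : Site 3), hτ_mem b⟩ with hτ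
  have hτc : τ c = refCentre 2 R := by
    apply Subtype.ext
    show planeProj (c : Site 3) = 0
    funext i; fin_cases i <;> rfl
  have hτinj_layer : ∀ (s : ℤ) (y z : abox (slabRadii R)), (y : Site 3) 2 = s → (z : Site 3) 2 = s →
      τ y = τ z → y = z := by
    intro s y z hy hz hyz
    have h : planeProj (y : Site 3) = planeProj (z : Site 3) := congrArg Subtype.val hyz
    have h0 : (y : Site 3) 0 = (z : Site 3) 0 := by simpa [planeProj] using congrFun h 0
    have h1 : (y : Site 3) 1 = (z : Site 3) 1 := by simpa [planeProj] using congrFun h 1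
    have h2 : (y : Site 3) 2 = (z : Site 3) 2 := by rw [hy, hz]
    apply Subtype.ext; funext i
    fin_cases i
    · exact h0
    · exact h1
    · exact h2
  have hτinjL : Set.InjOn τ L := fun y hy z hz hyz =>
    hτinj_layer 0 y z ((memL y).1 hy) ((memL z).1 hz) hyz
  set ref2 := refCoupling (fun x y : Site 2 => (β * Jp) / 2 * nnCoupling 2 x y) R with href2
  have href2_0 : ∀ q, 0 ≤ ref2 q :=
    refCoupling_nonneg (fun x y => mul_nonneg (by positivity) (nnCoupling_nonneg _ _)) R
  -- domination of the middle-layer system by the 2D reference box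
  have hdom : ∀ y ∈ L, ∀ z ∈ L, J₀ (y, z) ≤ ref2 (τ y, τ z) := by
    intro y hy z hz
    have hy2 := (memL y).1 hy
    have hz2 := (memL z).1 hz
    simp only [hJ₀, if_pos (And.intro hy2 hz2), haRef, aRefCoupling, href2, refCoupling]
    -- shell conditions agree
    have hshell : ∀ w : abox (slabRadii R), (w : Site 3) 2 = 0 →
        ((w : Site 3) ∉ aInterior (slabRadii R) ↔ Site.supNorm ((τ w : box 2 R) : Site 2) = R) := by
      intro w hw2
      have hwb := mem_slab_iff.1 w.2
      have hle : Site.supNorm ((τ w : box 2 R) : Site 2) ≤ R := mem_box_iff_supNorm_le.1 (τ w).2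
      rw [mem_slabInterior_iff]
      have hlt := supNorm_planeProj_lt_iff (y := (w : Site 3)) hR
      change (¬_ ↔ Site.supNorm (planeProj (w : Site 3)) = R)
      constructor
      · intro hn
        refine le_antisymm hle (not_lt.1 fun hlt' => hn ?_)
        exact ⟨(hlt.1 hlt').1, (hlt.1 hlt').2, hw2⟩
      · rintro heq ⟨g0, g1, -⟩
        have := hlt.2 ⟨g0, g1⟩
        omega
    by_cases hS : (y : Site 3) ∉ aInterior (slabRadii R) ∧ (z : Site 3) ∉ aInterior (slabRadii R)
    · rw [if_pos hS]
      split_ifs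
      · exact le_rfl
      · exact mul_nonneg (by positivity) (nnCoupling_nonneg _ _)
    · rw [if_neg hS, if_neg (by rwa [← hshell y hy2, ← hshell z hz2])]
      simp only [hJf, layeredCoupling, nnCoupling]
      rw [l1Norm_eq_planeProj (show (y : Site 3) 2 = (z : Site 3) 2 by rw [hy2, hz2])]
      have h2 : ((y : Site 3) - (z : Site 3)) 2 = 0 := by simp [hy2, hz2]
      simp only [h2, if_true]
      change β / 2 * (if l1Norm (planeProj (y : Site 3) - planeProj (z : Site 3)) = 1 then Jp else 0) ≤
        β * Jp / 2 * (if l1Norm (planeProj (y : Site 3) - planeProj (z : Site 3)) = 1 then 1 else 0)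
      split_ifs <;> nlinarith
  -- middle-layer two-point functions are bounded by the 2D reference box
  have hmid : ∀ y ∈ L, twoPoint J₀ c y ≤ twoPoint ref2 (refCentre 2 R) (τ y) := by
    intro y hy
    have h := twoPoint_le_of_injOn hJ₀0 hJ₀supp τ hτinjL href2_0 hdom hcL hy
    rwa [hτc] at h
  -- (i) the in-plane shell
  have hin : ∑ b ∈ (aShell (slabRadii R)).filter (fun b => b ∈ L), twoPoint aRef c b ≤ nnBoxShellSum (β * Jp) 2 R := by
    calc ∑ b ∈ (aShell (slabRadii R)).filter (fun b => b ∈ L), twoPoint aRef c b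
        ≤ ∑ b ∈ (aShell (slabRadii R)).filter (fun b => b ∈ L), twoPoint ref2 (refCentre 2 R) (τ b) := by
          refine Finset.sum_le_sum fun b hb => ?_
          have hbL := (Finset.mem_filter.1 hb).2
          rw [hdecomp, twoPoint_add_leaf_eq hfootL hJ₀supp hDsupp hcL hbL]
          exact hmid b hbL
      _ = ∑ b' ∈ ((aShell (slabRadii R)).filter (fun b => b ∈ L)).image τ, twoPoint ref2 (refCentre 2 R) b' := by
          rw [Finset.sum_image]
          intro y hy z hz hyz
          exact hτinjL (Finset.mem_filter.1 hy).2 (Finset.mem_filter.1 hz).2 hyz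
      _ ≤ nnBoxShellSum (β * Jp) 2 R := by
          unfold nnBoxShellSum boxShellSum
          refine Finset.sum_le_sum_of_subset_of_nonneg (fun b' hb' => ?_)
            fun b' _ _ => twoPoint_nonneg href2_0 _ _
          obtain ⟨b, hb, rfl⟩ := Finset.mem_image.1 hb'
          rw [Finset.mem_filter] at hb
          have hbS : (b : Site 3) ∉ aInterior (slabRadii R) := by
            have := hb.1; simp only [aShell, Finset.mem_filter] at this; exact this.2
          have hb2 := (memL b).1 hb.2
          simp only [refShell, Finset.mem_filter, Finset.mem_univ, true_and]
          -- shell of the slab in the middle layer = 2D shell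
          have hbb := mem_slab_iff.1 b.2
          have hle : Site.supNorm (planeProj (b : Site 3)) ≤ R := supNorm_planeProj_le_iff.2 ⟨hbb.1, hbb.2.1⟩
          refine le_antisymm hle (not_lt.1 fun hlt => hbS ?_)
          rw [mem_slabInterior_iff]
          exact ⟨((supNorm_planeProj_lt_iff hR).1 hlt).1, ((supNorm_planeProj_lt_iff hR).1 hlt).2, hb2⟩
  -- (ii) the vertical leaves and the free rotators of the outer layers
  have hcoup : ∀ x y : Site 3, x 2 ≠ y 2 → Jf x y ≤ β / 2 * Jz := by
    intro x y hxy
    simp only [hJf]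
    refine mul_le_mul_of_nonneg_left ?_ (by positivity)
    have hne : (x - y) 2 ≠ 0 := by simpa [Pi.sub_apply, sub_eq_zero] using hxy
    unfold layeredCoupling
    split_ifs <;> first | exact le_rfl | exact hz
  have hleaf : ∀ b : abox (slabRadii R), b ∉ L →
      twoPoint aRef c b ≤ (β * Jz / 2) *
        (if Site.supNorm ((τ b : box 2 R) : Site 2) < R then twoPoint ref2 (refCentre 2 R) (τ b) else 0) := by
    intro b hb
    have hb2 : (b : Site 3) 2 ≠ 0 := fun h => hb ((memL b).2 h)
    have hb_nint : (b : Site 3) ∉ aInterior (slabRadii R) := fun h => hb2 (hint2 h)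
    rw [hdecomp]
    refine (twoPoint_add_leaf_le hfootL hJ₀supp hDsupp hJ₀0 hD0 hcL hb).trans ?_
    rw [Finset.sum_eq_single_of_mem (foot b) (hfootL b hb) ?_]
    · -- the foot term
      have hfL : foot b ∈ L := hfootL b hb
      have hτf : τ (foot b) = τ b := by
        apply Subtype.ext
        show planeProj ((foot b : abox (slabRadii R)) : Site 3) = planeProj (b : Site 3)
        unfold planeProj
        rw [foot0, foot1]
      have hfint : ((foot b : abox (slabRadii R)) : Site 3) ∈ aInterior (slabRadii R) ↔ Site.supNorm ((τ b : box 2 R) : Site 2) < R := by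
        rw [mem_slabInterior_iff, foot0, foot1, foot2]
        show _ ↔ Site.supNorm (planeProj (b : Site 3)) < R
        rw [supNorm_planeProj_lt_iff hR]
        simp
      have hDsum : D (b, foot b) + D (foot b, b) ≤
          if Site.supNorm ((τ b : box 2 R) : Site 2) < R then β * Jz else 0 := by
        have hD1 : D (b, foot b) ≤ aRef (b, foot b) := by
          simp only [hD]; split_ifs; exacts [le_rfl, haRef0 _]
        have hD2 : D (foot b, b) ≤ aRef (foot b, b) := by
          simp only [hD]; split_ifs; exacts [le_rfl, haRef0 _]
        by_cases hfi : ((foot b : abox (slabRadii R)) : Site 3) ∈ aInterior (slabRadii R)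
        · rw [if_pos (hfint.1 hfi)]
          have h1 : aRef (b, foot b) ≤ β / 2 * Jz := by
            simp only [haRef, aRefCoupling]
            split_ifs
            · positivity
            · exact hcoup _ _ (by rw [foot2]; exact hb2)
          have h2 : aRef (foot b, b) ≤ β / 2 * Jz := by
            simp only [haRef, aRefCoupling]
            split_ifs
            · positivity
            · exact hcoup _ _ (by rw [foot2]; exact fun h => hb2 h.symm)
          linarith
        · rw [if_neg (fun h => hfi (hfint.2 h))]
          have h1 : aRef (b, foot b) = 0 := by
            simp only [haRef, aRefCoupling]; rw [if_pos ⟨hb_nint, hfi⟩]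
          have h2 : aRef (foot b, b) = 0 := by
            simp only [haRef, aRefCoupling]; rw [if_pos ⟨hfi, hb_nint⟩]
          linarith
      have hG : twoPoint J₀ (foot b) c ≤ twoPoint ref2 (refCentre 2 R) (τ b) := by
        rw [twoPoint_comm, ← hτf]; exact hmid (foot b) hfL
      have hG0 : 0 ≤ twoPoint J₀ (foot b) c := twoPoint_nonneg hJ₀0 _ _
      have hDsum0 : 0 ≤ D (b, foot b) + D (foot b, b) := add_nonneg (hD0 _) (hD0 _)
      split_ifs at hDsum ⊢ with hlt
      · calc (1 / 2 : ℝ) * ((D (b, foot b) + D (foot b, b)) * twoPoint J₀ (foot b) c)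
            ≤ (1 / 2 : ℝ) * ((β * Jz) * twoPoint ref2 (refCentre 2 R) (τ b)) :=
              mul_le_mul_of_nonneg_left (mul_le_mul hDsum hG hG0 (by positivity)) (by norm_num)
          _ = β * Jz / 2 * twoPoint ref2 (refCentre 2 R) (τ b) := by ring
      · have h0 : D (b, foot b) + D (foot b, b) = 0 := le_antisymm hDsum hDsum0
        rw [h0]; simp
    · -- the other middle-layer sites carry no dangling bond to `b`
      intro y hy hne
      have hy2 := (memL y).1 hy
      have hz1 : D (b, y) = 0 := by
        by_contra h
        have : aRef (b, y) ≠ 0 := by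
          intro h0; apply h; simp only [hD]; split_ifs <;> [exact h0; rfl]
        exact hne (hvert b y hb2 hy2 (Or.inl this))
      have hz2 : D (y, b) = 0 := by
        by_contra h
        have : aRef (y, b) ≠ 0 := by
          intro h0; apply h; simp only [hD]; split_ifs <;> [exact h0; rfl]
        exact hne (hvert b y hb2 hy2 (Or.inr this))
      rw [hz1, hz2, add_zero, zero_mul]
  -- summing the leaf bounds layer by layer
  set g : box 2 R → ℝ := fun y =>
    if Site.supNorm (y : Site 2) < R then twoPoint ref2 (refCentre 2 R) y else 0 with hg
  have hg0 : ∀ y, 0 ≤ g y := fun y => by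
    simp only [hg]; split_ifs; exacts [twoPoint_nonneg href2_0 _ _, le_rfl]
  have hgsum : ∑ y : box 2 R, g y = boxInteriorSum (β * Jp) R := by
    simp only [hg, boxInteriorSum, href2]
    rw [Finset.sum_filter]
  have hlayer : ∀ s : ℤ,
      ∑ b ∈ (Finset.univ : Finset (abox (slabRadii R))).filter (fun b : abox (slabRadii R) => (b : Site 3) 2 = s),
        g (τ b) ≤ boxInteriorSum (β * Jp) R := by
    intro s
    rw [← Finset.sum_image (f := g) (fun y hy z hz hyz =>
      hτinj_layer s y z (Finset.mem_filter.1 hy).2 (Finset.mem_filter.1 hz).2 hyz), ← hgsum]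
    exact Finset.sum_le_sum_of_subset_of_nonneg (Finset.subset_univ _) fun y _ _ => hg0 y
  set T : Finset (abox (slabRadii R)) := (aShell (slabRadii R)).filter (fun b => b ∉ L) with hT
  set Tp : Finset (abox (slabRadii R)) :=
    Finset.univ.filter (fun b : abox (slabRadii R) => (b : Site 3) 2 = 1) with hTp
  set Tm : Finset (abox (slabRadii R)) :=
    Finset.univ.filter (fun b : abox (slabRadii R) => (b : Site 3) 2 = -1) with hTm
  have hsub : T ⊆ Tp ∪ Tm := by
    intro b hb
    have hbL : b ∉ L := (Finset.mem_filter.1 hb).2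
    have hb2 : (b : Site 3) 2 ≠ 0 := fun h => hbL ((memL b).2 h)
    have hb1 : ((b : Site 3) 2).natAbs ≤ 1 := (mem_slab_iff.1 b.2).2.2
    rw [Finset.mem_union, hTp, hTm, Finset.mem_filter, Finset.mem_filter]
    simp only [Finset.mem_univ, true_and]
    omega
  have hdisj : Disjoint Tp Tm := by
    rw [hTp, hTm, Finset.disjoint_filter]
    intro b _ h1 h2
    omega
  have hgT : ∑ b ∈ T, g (τ b) ≤ 2 * boxInteriorSum (β * Jp) R :=
    calc ∑ b ∈ T, g (τ b) ≤ ∑ b ∈ Tp ∪ Tm, g (τ b) :=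
          Finset.sum_le_sum_of_subset_of_nonneg hsub fun b _ _ => hg0 _
      _ = ∑ b ∈ Tp, g (τ b) + ∑ b ∈ Tm, g (τ b) := Finset.sum_union hdisj
      _ ≤ boxInteriorSum (β * Jp) R + boxInteriorSum (β * Jp) R := add_le_add (hlayer 1) (hlayer (-1))
      _ = 2 * boxInteriorSum (β * Jp) R := by ring
  have hout : ∑ b ∈ T, twoPoint aRef c b ≤ β * Jz * boxInteriorSum (β * Jp) R :=
    calc ∑ b ∈ T, twoPoint aRef c b ≤ ∑ b ∈ T, (β * Jz / 2) * g (τ b) :=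
          Finset.sum_le_sum fun b hb => hleaf b (Finset.mem_filter.1 hb).2
      _ = (β * Jz / 2) * ∑ b ∈ T, g (τ b) := by rw [Finset.mul_sum]
      _ ≤ (β * Jz / 2) * (2 * boxInteriorSum (β * Jp) R) :=
          mul_le_mul_of_nonneg_left hgT (div_nonneg (mul_nonneg hβ hz) zero_le_two)
      _ = β * Jz * boxInteriorSum (β * Jp) R := by ring
  -- assemble
  have hsplit : slabShellSum β Jp Jz R =
      ∑ b ∈ (aShell (slabRadii R)).filter (fun b => b ∈ L), twoPoint aRef c b + ∑ b ∈ T, twoPoint aRef c b := by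
    rw [hT, Finset.sum_filter_add_sum_filter_not]
    rfl
  rw [hsplit]
  exact add_le_add hin hout

/-- **Three-dimensional decay of the layered XY model from two-dimensional box data.** For `β, J∥, J⊥ ≥ 0`,
`R ≥ 1`, every finite `Λ ⊂ ℤ³` (free boundary conditions) and `a, c ∈ Λ`:

  `⟨cos(θ_a − θ_c)⟩_{Λ,β} ≤ (S_R(βJ∥) + β J⊥ χ^{int}_R(βJ∥))^{max(⌊|a₀−c₀|/R⌋, ⌊|a₁−c₁|/R⌋, |a₂−c₂|)}`

(`twoPoint_layered_le_pow_slabShellSum` with `slabShellSum_le_box2D`). So `k_B T_c^{3D-XY}(J∥, J⊥) ≤ T` as soon as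
`S_R(J∥/T) + (J⊥/T)·χ^{int}_R(J∥/T) < 1` — two numbers of ONE two-dimensional box.
[cite: Lieb1980, eq. (23) and p. 128 (boxes; finite algorithm); AizenmanSimon1980LocalWard, Thm 3.1 (N = 2); LiuStanley1972, p. 272 (layers (J, J, εJ))] -/
theorem twoPoint_layered_le_pow_box2D {β Jp Jz : ℝ} (hβ : 0 ≤ β) (hp : 0 ≤ Jp) (hz : 0 ≤ Jz) {R : ℕ}
    (hR : 1 ≤ R) (Λ : Finset (Site 3)) (a c : Λ) :
    twoPoint (layeredXYCoupling β Jp Jz Λ) a c ≤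
      (nnBoxShellSum (β * Jp) 2 R + β * Jz * boxInteriorSum (β * Jp) R) ^
        aIndex (slabRadii R) ((a : Site 3) - (c : Site 3)) := by
  refine (twoPoint_layered_le_pow_slabShellSum hβ hp hz hR Λ a c).trans ?_
  exact pow_le_pow_left₀ (aboxShellSum_nonneg
    (fun x y => mul_nonneg (by positivity) (layeredCoupling_nonneg hp hz _ _)) _)
    (slabShellSum_le_box2D hβ hp hz hR) _

/-- **Decay across the layers from two-dimensional box data** (the box-localised layer-decoupling bound): if
`S_R(βJ∥) + β J⊥ χ^{int}_R(βJ∥) ≤ 1` then for every finite `Λ ⊂ ℤ³` and `a, c ∈ Λ`,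
`⟨cos(θ_a − θ_c)⟩_{Λ,β} ≤ (S_R(βJ∥) + β J⊥ χ^{int}_R(βJ∥))^{|ℓ(a) − ℓ(c)|}`. Compare
`twoPoint_layered_le_pow_interlayer'` (base `βJ⊥χ` with `χ` the susceptibility of a whole layer of `Λ`): here
both inputs are fixed numbers of the reference box `[−R,R]²`, and the bound is informative down to `J⊥ → 0`
(`S_R < 1`). [cite: Lieb1980, eq. (23) and p. 128 (boxes); AizenmanSimon1980LocalWard, Thm 3.1 (N = 2); LiuStanley1972, p. 272] -/
theorem twoPoint_layered_le_pow_box2D_layer {β Jp Jz : ℝ} (hβ : 0 ≤ β) (hp : 0 ≤ Jp) (hz : 0 ≤ Jz) {R : ℕ}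
    (hR : 1 ≤ R) (h1 : nnBoxShellSum (β * Jp) 2 R + β * Jz * boxInteriorSum (β * Jp) R ≤ 1)
    (Λ : Finset (Site 3)) (a c : Λ) :
    twoPoint (layeredXYCoupling β Jp Jz Λ) a c ≤
      (nnBoxShellSum (β * Jp) 2 R + β * Jz * boxInteriorSum (β * Jp) R) ^ (((a : Site 3) - (c : Site 3)) 2).natAbs := by
  have h0 : 0 ≤ nnBoxShellSum (β * Jp) 2 R + β * Jz * boxInteriorSum (β * Jp) R :=
    add_nonneg (boxShellSum_nonneg (fun x y => mul_nonneg (by positivity) (nnCoupling_nonneg _ _)) R)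
      (mul_nonneg (mul_nonneg hβ hz) (boxInteriorSum_nonneg (mul_nonneg hβ hp) R))
  refine (twoPoint_layered_le_pow_box2D hβ hp hz hR Λ a c).trans (pow_le_pow_of_le_one h0 h1 ?_)
  have h := div_le_aIndex (slabRadii R) ((a : Site 3) - (c : Site 3)) 2
  simpa [slabRadii] using h

end SlabReduction

end PlaneRotator

end Literature.Probability.LatticeModels

end
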